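import Summits.Ventures.LatticeQCDFlow.Scaling.SimulatedTemperingLevelKernel

/-!
HONEST FRAMING: exact (Metropolis-corrected) sampling algorithms for lattice gauge theory; figures
of merit are autocorrelation/cost numbers at stated couplings and volumes; no continuum-physics
claim.

# SimulatedTemperingLevelKernelBalance — DETAILED BALANCE OF THE EXACT-WEIGHT METROPOLIS LEVEL KERNEL WITH
# RESPECT TO THE EXACT-WEIGHT SIMULATED-TEMPERING TARGET; HENCE INVARIANCE (lean-2 GEN-14, ours)

Venture-side (OURS).  Cell `lqcd-flow` (pub-lqcd), unit `pub-lqcd-lean-2-g14`, 2026-08-24.  Hypothesis (i) of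
GEN-13's level autocorrelation law (`Scaling/SimulatedTemperingDiffusive.st_level_lagOneAutocorr_ge`:
`Kernel.Invariant κ (stTarget X μ β K)`) for the level kernel CONSTRUCTED in
`Scaling/SimulatedTemperingLevelKernel` (`stLevelKernel hXm μ β K`: propose `k ± 1` with probability `½`,
accept with `min(1, p_{β_{k±1}}(x)/p_{β_k}(x))`, `p_u = e^{uX}/mgf(u)`), in the strong form of DETAILED BALANCE
— Mathlib's `Kernel.IsReversible κ π : ∀ A B measurable, ∫⁻_{A} κ(·,B) dπ = ∫⁻_{B} κ(·,A) dπ` — which is also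
the hypothesis of the reversible `τ_int` floor (`Scaling/TemperingLevelTauInt`, row 8's Madras–Slade floor).
The mechanism is the rung-by-rung flux identity `u(k,x)·p_{β_k}(x) = d(k+1,x)·p_{β_{k+1}}(x) =
½·min(p_{β_k}(x), p_{β_{k+1}}(x))`.

## What is proved (`X` measurable; for the balance statements `μ` a probability measure and `X` bounded, so
## that every `mgf(β_k) > 0`)

* **`st_flux_detailedBalance`** — `∫⁻ ½min(1, p_t/p_s)·g dμ_s = ∫⁻ ½min(1, p_s/p_t)·g dμ_t` (both are
  `∫⁻ ½min(p_s, p_t)·g dμ`); **`stDown_flux_eq_stUp_flux`** — `∫⁻ d(i+1,·)·g dμ_{β_{i+1}} = ∫⁻ u(i,·)·g dμ_{β_i}`.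
* `stFlux X μ β K A B = Σ_{i<K} ∫⁻ 1_A(i,x)·1_B(i+1,x)·u(i,x) dμ_{β_i}` (up-flux functional) and
  `stStay X μ β K A B = Σ_k ∫⁻ 1_A(k,x)·1_B(k,x)·(1−u−d)(k,x) dμ_{β_k}` (symmetric, `stStay_comm`);
  `sum_upTerm_eq_stFlux`, **`sum_downTerm_eq_stFlux`** (the down-move terms of `A → B` ARE the up-flux
  `B → A`), **`setLIntegral_stLevelKernel`**: `∫⁻_A κ(·,B) dπ = (K+1)⁻¹·(F(A,B) + F(B,A) + S(A,B))`.
* **`isReversible_stLevelKernel`** — `Kernel.IsReversible (stLevelKernel hXm μ β K) (stTarget X μ β K)`;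
  **`invariant_stLevelKernel`** — `Kernel.Invariant (stLevelKernel hXm μ β K) (stTarget X μ β K)` (hypothesis (i)).

NOT CLAIMED: anything beyond the level kernel itself (compositions / mixtures with within-level dynamics are
the companion files); estimated weights (then the flux identity fails and the uniform level marginal is lost).
Literature grade (cell rule): TEXTBOOK (detailed balance of Metropolis on the extended space — Marinari–Parisi
1992; Geyer–Thompson 1995), NEW TYPING (general measurable `Ω`, Mathlib `Kernel.IsReversible`); nothing cited
as a fact; no new bib keys.
-/

noncomputable section

open MeasureTheory ProbabilityTheory Set Filter Finset
open scoped ENNReal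

namespace Summit.Ventures.LatticeQCDFlow.Scaling

/-! ## §4 Detailed balance with respect to the exact-weight target -/

section DetailedBalance

variable {Ω : Type*} [MeasurableSpace Ω] {X : Ω → ℝ} {μ : Measure Ω} {β : ℕ → ℝ} {K : ℕ}

/-- **THE FLUX IDENTITY (detailed balance of the level move between rungs `k` and `k+1`)**: for measurable
`g ≥ 0`, `∫⁻ ½min(1, p_{k+1}/p_k)·g dμ_{β_k} = ∫⁻ ½min(1, p_k/p_{k+1})·g dμ_{β_{k+1}}` — both sides equal
`∫⁻ ½min(p_k, p_{k+1})·g dμ` (`μ` a probability measure, `X` bounded measurable). [ours] -/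
theorem st_flux_detailedBalance [IsProbabilityMeasure μ] (hXm : Measurable X) (hXb : ∃ C, ∀ x, |X x| ≤ C)
    (s t : ℝ) {g : Ω → ℝ≥0∞} :
    ∫⁻ x, ENNReal.ofReal (1 / 2 * min 1 ((Real.exp (t * X x) / mgf X μ t) / (Real.exp (s * X x) / mgf X μ s)))
        * g x ∂(μ.tilted fun x => s * X x) =
      ∫⁻ x, ENNReal.ofReal (1 / 2 * min 1 ((Real.exp (s * X x) / mgf X μ s) / (Real.exp (t * X x) / mgf X μ t)))
        * g x ∂(μ.tilted fun x => t * X x) := by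
  rw [lintegral_tilted, lintegral_tilted]
  have hmgf : ∀ u : ℝ, ∫ x, Real.exp (u * X x) ∂μ = mgf X μ u := fun u => rfl
  simp only [hmgf]
  refine lintegral_congr fun x => ?_
  have hps : 0 < Real.exp (s * X x) / mgf X μ s := div_pos (Real.exp_pos _) (mgf_pos_of_bounded hXm hXb s)
  have hpt : 0 < Real.exp (t * X x) / mgf X μ t := div_pos (Real.exp_pos _) (mgf_pos_of_bounded hXm hXb t)
  rw [← mul_assoc, ← mul_assoc, ← ENNReal.ofReal_mul hps.le, ← ENNReal.ofReal_mul hpt.le]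
  congr 2
  rw [mul_left_comm, mul_min_of_nonneg _ _ hps.le, mul_one, mul_div_cancel₀ _ hps.ne', mul_left_comm,
    mul_min_of_nonneg _ _ hpt.le, mul_one, mul_div_cancel₀ _ hpt.ne', min_comm]

/-- **The flux identity for the move probabilities**: for `i < K` and measurable `g ≥ 0`,
`∫⁻ d(i+1, ·)·g dμ_{β_{i+1}} = ∫⁻ u(i, ·)·g dμ_{β_i}` — the stationary probability flux of the level move
`i+1 → i` equals that of `i → i+1`. [ours] -/
theorem stDown_flux_eq_stUp_flux [IsProbabilityMeasure μ] (hXm : Measurable X) (hXb : ∃ C, ∀ x, |X x| ≤ C)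
    (i : Fin K) (g : Ω → ℝ≥0∞) :
    ∫⁻ x, ENNReal.ofReal (stDownProb X μ β K (Fin.succ i, x)) * g x
        ∂(μ.tilted fun x => β (Fin.succ i : Fin (K + 1)) * X x) =
      ∫⁻ x, ENNReal.ofReal (stUpProb X μ β K (Fin.castSucc i, x)) * g x
        ∂(μ.tilted fun x => β (Fin.castSucc i : Fin (K + 1)) * X x) := by
  have hi1 : 1 ≤ ((Fin.succ i : Fin (K + 1)) : ℕ) := by simp
  have hi2 : ((Fin.castSucc i : Fin (K + 1)) : ℕ) < K := by simp
  have ed : ∀ x, stDownProb X μ β K (Fin.succ i, x) =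
      1 / 2 * min 1 ((Real.exp (β (i : ℕ) * X x) / mgf X μ (β (i : ℕ))) /
        (Real.exp (β ((i : ℕ) + 1) * X x) / mgf X μ (β ((i : ℕ) + 1)))) := fun x => by
    unfold stDownProb; rw [if_pos hi1]; simp
  have eu : ∀ x, stUpProb X μ β K (Fin.castSucc i, x) =
      1 / 2 * min 1 ((Real.exp (β ((i : ℕ) + 1) * X x) / mgf X μ (β ((i : ℕ) + 1))) /
        (Real.exp (β (i : ℕ) * X x) / mgf X μ (β (i : ℕ)))) := fun x => by
    unfold stUpProb; rw [if_pos hi2]; simp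
  simp only [ed, eu, Fin.val_succ, Fin.val_castSucc]
  exact (st_flux_detailedBalance hXm hXb (β (i : ℕ)) (β ((i : ℕ) + 1))).symm

/-- The stationary UP-FLUX functional `F(A, B) = Σ_{i<K} ∫⁻ 1_A(i,x)·1_B(i+1,x)·u(i,x) dμ_{β_i}(x)` (times
`(K+1)⁻¹` it is the stationary probability of being in `A` at level `i` and moving up into `B`). [ours] -/
def stFlux (X : Ω → ℝ) (μ : Measure Ω) (β : ℕ → ℝ) (K : ℕ) (A B : Set (Fin (K + 1) × Ω)) : ℝ≥0∞ :=
  ∑ i : Fin K, ∫⁻ x, A.indicator 1 ((Fin.castSucc i, x) : Fin (K + 1) × Ω) *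
    B.indicator 1 ((Fin.succ i, x) : Fin (K + 1) × Ω) * ENNReal.ofReal (stUpProb X μ β K (Fin.castSucc i, x))
      ∂(μ.tilted fun x => β (Fin.castSucc i : Fin (K + 1)) * X x)

/-- The stationary STAY functional `S(A, B) = Σ_k ∫⁻ 1_A(k,x)·1_B(k,x)·(1 − u − d)(k,x) dμ_{β_k}(x)`. [ours] -/
def stStay (X : Ω → ℝ) (μ : Measure Ω) (β : ℕ → ℝ) (K : ℕ) (A B : Set (Fin (K + 1) × Ω)) : ℝ≥0∞ :=
  ∑ k : Fin (K + 1), ∫⁻ x, A.indicator 1 ((k, x) : Fin (K + 1) × Ω) * B.indicator 1 ((k, x) : Fin (K + 1) × Ω) *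
    ENNReal.ofReal (1 - stUpProb X μ β K (k, x) - stDownProb X μ β K (k, x)) ∂(μ.tilted fun x => β k * X x)

/-- The stay functional is symmetric. [ours] -/
theorem stStay_comm (A B : Set (Fin (K + 1) × Ω)) : stStay X μ β K A B = stStay X μ β K B A := by
  unfold stStay
  refine Finset.sum_congr rfl fun k _ => lintegral_congr fun x => ?_
  ring

/-- The up-move terms of `∫⁻_A κ(·,B) dπ` sum to the up-flux `F(A, B)` (the top rung has `u = 0`). [ours] -/
theorem sum_upTerm_eq_stFlux (A B : Set (Fin (K + 1) × Ω)) :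
    ∑ k : Fin (K + 1), ∫⁻ x, A.indicator 1 ((k, x) : Fin (K + 1) × Ω) *
        B.indicator 1 ((levUp K k, x) : Fin (K + 1) × Ω) * ENNReal.ofReal (stUpProb X μ β K (k, x))
          ∂(μ.tilted fun x => β k * X x) = stFlux X μ β K A B := by
  rw [Fin.sum_univ_castSucc]
  have e : ∀ x, stUpProb X μ β K (Fin.last K, x) = 0 := fun x => by
    unfold stUpProb; rw [if_neg (by simp)]
  have hlast : ∫⁻ x, A.indicator 1 ((Fin.last K, x) : Fin (K + 1) × Ω) *
      B.indicator 1 ((levUp K (Fin.last K), x) : Fin (K + 1) × Ω) * ENNReal.ofReal (stUpProb X μ β K (Fin.last K, x))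
        ∂(μ.tilted fun x => β (Fin.last K : Fin (K + 1)) * X x) = 0 := by
    simp [e]
  rw [hlast, add_zero]
  unfold stFlux
  refine Finset.sum_congr rfl fun i _ => ?_
  have hi : ((Fin.castSucc i : Fin (K + 1)) : ℕ) < K := by simp
  have hup : levUp K (Fin.castSucc i) = Fin.succ i := Fin.ext (by rw [levUp_val_of_lt hi]; simp)
  rw [hup]

/-- The down-move terms of `∫⁻_A κ(·,B) dπ` sum to the REVERSED up-flux `F(B, A)` — detailed balance rung by
rung (the bottom rung has `d = 0`). [ours] -/
theorem sum_downTerm_eq_stFlux [IsProbabilityMeasure μ] (hXm : Measurable X) (hXb : ∃ C, ∀ x, |X x| ≤ C)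
    (A B : Set (Fin (K + 1) × Ω)) :
    ∑ k : Fin (K + 1), ∫⁻ x, A.indicator 1 ((k, x) : Fin (K + 1) × Ω) *
        B.indicator 1 ((levDown K k, x) : Fin (K + 1) × Ω) * ENNReal.ofReal (stDownProb X μ β K (k, x))
          ∂(μ.tilted fun x => β k * X x) = stFlux X μ β K B A := by
  rw [Fin.sum_univ_succ]
  have e : ∀ x, stDownProb X μ β K (0, x) = 0 := fun x => by
    unfold stDownProb; rw [if_neg (by simp)]
  have hzero : ∫⁻ x, A.indicator 1 (((0 : Fin (K + 1)), x) : Fin (K + 1) × Ω) *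
      B.indicator 1 ((levDown K 0, x) : Fin (K + 1) × Ω) * ENNReal.ofReal (stDownProb X μ β K (0, x))
        ∂(μ.tilted fun x => β ((0 : Fin (K + 1)) : ℕ) * X x) = 0 := by
    simp [e]
  rw [hzero, zero_add]
  unfold stFlux
  refine Finset.sum_congr rfl fun i _ => ?_
  have hdown : levDown K (Fin.succ i) = Fin.castSucc i := Fin.ext (by simp)
  rw [hdown]
  have el : ∫⁻ x, A.indicator 1 ((Fin.succ i, x) : Fin (K + 1) × Ω) *
      B.indicator 1 ((Fin.castSucc i, x) : Fin (K + 1) × Ω) * ENNReal.ofReal (stDownProb X μ β K (Fin.succ i, x))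
        ∂(μ.tilted fun x => β (Fin.succ i : Fin (K + 1)) * X x) =
      ∫⁻ x, ENNReal.ofReal (stDownProb X μ β K (Fin.succ i, x)) *
        (B.indicator 1 ((Fin.castSucc i, x) : Fin (K + 1) × Ω) * A.indicator 1 ((Fin.succ i, x) : Fin (K + 1) × Ω))
          ∂(μ.tilted fun x => β (Fin.succ i : Fin (K + 1)) * X x) :=
    lintegral_congr fun x => by ring
  have er : ∫⁻ x, B.indicator 1 ((Fin.castSucc i, x) : Fin (K + 1) × Ω) *
      A.indicator 1 ((Fin.succ i, x) : Fin (K + 1) × Ω) * ENNReal.ofReal (stUpProb X μ β K (Fin.castSucc i, x))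
        ∂(μ.tilted fun x => β (Fin.castSucc i : Fin (K + 1)) * X x) =
      ∫⁻ x, ENNReal.ofReal (stUpProb X μ β K (Fin.castSucc i, x)) *
        (B.indicator 1 ((Fin.castSucc i, x) : Fin (K + 1) × Ω) * A.indicator 1 ((Fin.succ i, x) : Fin (K + 1) × Ω))
          ∂(μ.tilted fun x => β (Fin.castSucc i : Fin (K + 1)) * X x) :=
    lintegral_congr fun x => by ring
  rw [el, er]
  exact stDown_flux_eq_stUp_flux hXm hXb i _

/-- **`∫⁻_A κ(·, B) dπ = (K+1)⁻¹·(F(A,B) + F(B,A) + S(A,B))`** — the expansion of the stationary flow from `A`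
into `B` along the levels. [ours] -/
theorem setLIntegral_stLevelKernel [IsProbabilityMeasure μ] (hXm : Measurable X) (hXb : ∃ C, ∀ x, |X x| ≤ C)
    {A B : Set (Fin (K + 1) × Ω)} (hA : MeasurableSet A) (hB : MeasurableSet B) :
    ∫⁻ z in A, stLevelKernel hXm μ β K z B ∂(stTarget X μ β K) =
      ((K + 1 : ℕ) : ℝ≥0∞)⁻¹ * (stFlux X μ β K A B + stFlux X μ β K B A + stStay X μ β K A B) := by
  rw [← lintegral_indicator hA, lintegral_stTarget (((stLevelKernel hXm μ β K).measurable_coe hB).indicator hA)]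
  congr 1
  -- pointwise: `1_A(z)·κ(z,B)` is the sum of the three terms
  have hpt : ∀ (k : Fin (K + 1)) (x : Ω), A.indicator (fun z => stLevelKernel hXm μ β K z B) ((k, x)) =
      A.indicator 1 ((k, x) : Fin (K + 1) × Ω) * B.indicator 1 ((levUp K k, x) : Fin (K + 1) × Ω) *
          ENNReal.ofReal (stUpProb X μ β K (k, x)) +
        A.indicator 1 ((k, x) : Fin (K + 1) × Ω) * B.indicator 1 ((levDown K k, x) : Fin (K + 1) × Ω) *
          ENNReal.ofReal (stDownProb X μ β K (k, x)) +
        A.indicator 1 ((k, x) : Fin (K + 1) × Ω) * B.indicator 1 ((k, x) : Fin (K + 1) × Ω) *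
          ENNReal.ofReal (1 - stUpProb X μ β K (k, x) - stDownProb X μ β K (k, x)) := by
    intro k x
    by_cases hz : ((k, x) : Fin (K + 1) × Ω) ∈ A
    · rw [Set.indicator_of_mem hz, Set.indicator_of_mem hz, stLevelKernel_apply' hXm _ hB]
      simp only [Pi.one_apply, one_mul]
      ring
    · rw [Set.indicator_of_notMem hz, Set.indicator_of_notMem hz]
      simp
  -- measurability of the three terms (to split the integrals)
  have hiA : ∀ k : Fin (K + 1), Measurable fun x : Ω => A.indicator (1 : Fin (K + 1) × Ω → ℝ≥0∞) ((k, x)) :=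
    fun k => measurable_indicator_one_comp measurable_prodMk_left hA
  have hiB : ∀ (f : Fin (K + 1) → Fin (K + 1)) (k : Fin (K + 1)),
      Measurable fun x : Ω => B.indicator (1 : Fin (K + 1) × Ω → ℝ≥0∞) ((f k, x) : Fin (K + 1) × Ω) :=
    fun f k => measurable_indicator_one_comp measurable_prodMk_left hB
  have hu : ∀ k : Fin (K + 1), Measurable fun x : Ω => ENNReal.ofReal (stUpProb X μ β K (k, x)) := fun k =>
    ((measurable_stUpProb (μ := μ) (β := β) (K := K) hXm).comp measurable_prodMk_left).ennreal_ofReal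
  have hd : ∀ k : Fin (K + 1), Measurable fun x : Ω => ENNReal.ofReal (stDownProb X μ β K (k, x)) := fun k =>
    ((measurable_stDownProb (μ := μ) (β := β) (K := K) hXm).comp measurable_prodMk_left).ennreal_ofReal
  have hT1 : ∀ k : Fin (K + 1), Measurable fun x : Ω => A.indicator 1 ((k, x) : Fin (K + 1) × Ω) *
      B.indicator 1 ((levUp K k, x) : Fin (K + 1) × Ω) * ENNReal.ofReal (stUpProb X μ β K (k, x)) :=
    fun k => ((hiA k).mul (hiB (levUp K) k)).mul (hu k)
  have hT2 : ∀ k : Fin (K + 1), Measurable fun x : Ω => A.indicator 1 ((k, x) : Fin (K + 1) × Ω) *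
      B.indicator 1 ((levDown K k, x) : Fin (K + 1) × Ω) * ENNReal.ofReal (stDownProb X μ β K (k, x)) :=
    fun k => ((hiA k).mul (hiB (levDown K) k)).mul (hd k)
  have hT12 : ∀ k : Fin (K + 1), Measurable fun x : Ω =>
      A.indicator 1 ((k, x) : Fin (K + 1) × Ω) * B.indicator 1 ((levUp K k, x) : Fin (K + 1) × Ω) *
          ENNReal.ofReal (stUpProb X μ β K (k, x)) +
        A.indicator 1 ((k, x) : Fin (K + 1) × Ω) * B.indicator 1 ((levDown K k, x) : Fin (K + 1) × Ω) *
          ENNReal.ofReal (stDownProb X μ β K (k, x)) := fun k => (hT1 k).add (hT2 k)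
  have hsplit : ∀ k : Fin (K + 1), ∫⁻ x, A.indicator (fun z => stLevelKernel hXm μ β K z B) ((k, x))
      ∂(μ.tilted fun x => β k * X x) =
      ∫⁻ x, A.indicator 1 ((k, x) : Fin (K + 1) × Ω) * B.indicator 1 ((levUp K k, x) : Fin (K + 1) × Ω) *
          ENNReal.ofReal (stUpProb X μ β K (k, x)) ∂(μ.tilted fun x => β k * X x) +
      ∫⁻ x, A.indicator 1 ((k, x) : Fin (K + 1) × Ω) * B.indicator 1 ((levDown K k, x) : Fin (K + 1) × Ω) *
          ENNReal.ofReal (stDownProb X μ β K (k, x)) ∂(μ.tilted fun x => β k * X x) +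
      ∫⁻ x, A.indicator 1 ((k, x) : Fin (K + 1) × Ω) * B.indicator 1 ((k, x) : Fin (K + 1) × Ω) *
          ENNReal.ofReal (1 - stUpProb X μ β K (k, x) - stDownProb X μ β K (k, x))
        ∂(μ.tilted fun x => β k * X x) := by
    intro k
    simp only [hpt]
    rw [lintegral_add_left (hT12 k), lintegral_add_left (hT1 k)]
  simp only [hsplit, Finset.sum_add_distrib]
  rw [sum_upTerm_eq_stFlux, sum_downTerm_eq_stFlux hXm hXb]
  rfl

/-- **DETAILED BALANCE: THE LEVEL KERNEL IS REVERSIBLE WITH RESPECT TO THE EXACT-WEIGHT TARGET**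
(`μ` a probability measure, `X` bounded measurable): `∫⁻_{A} κ(·,B) dπ = ∫⁻_{B} κ(·,A) dπ` for all measurable
`A, B`, `π = stTarget X μ β K`. [ours] -/
theorem isReversible_stLevelKernel [IsProbabilityMeasure μ] (hXm : Measurable X) (hXb : ∃ C, ∀ x, |X x| ≤ C) :
    Kernel.IsReversible (stLevelKernel hXm μ β K) (stTarget X μ β K) := by
  intro A B hA hB
  rw [setLIntegral_stLevelKernel hXm hXb hA hB, setLIntegral_stLevelKernel hXm hXb hB hA, stStay_comm A B]
  ring

/-- **(i) THE LEVEL KERNEL LEAVES THE EXACT-WEIGHT TARGET INVARIANT** (`μ` a probability measure, `X` bounded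
measurable). [ours] -/
theorem invariant_stLevelKernel [IsProbabilityMeasure μ] (hXm : Measurable X) (hXb : ∃ C, ∀ x, |X x| ≤ C) :
    Kernel.Invariant (stLevelKernel hXm μ β K) (stTarget X μ β K) :=
  (isReversible_stLevelKernel hXm hXb).invariant

end DetailedBalance

end Summit.Ventures.LatticeQCDFlow.Scaling

end
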